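import Mathlib

/-!
# SoloBlindNormOneSpan — the quotients `z / σ z` span an algebraic field with involution

solo-HodgeConjecture-blind, session s19 (`paper/k3-weil-faces.md` §1, Lemma 1.1, CORRECTED).

Let `K` be a field of characteristic `0` which is algebraic over `ℚ`, and `σ : K ≃+* K` an involutive
ring automorphism, `σ ≠ id`.  Then the `ℚ`-linear span of the set `N¹ = {z / σ z : z ≠ 0}` is all of `K`.

Application (loc. cit. Cor. 1.2): for a complex projective K3 surface `S` whose endomorphism field
`K = End_Hdg T(S)_ℚ` is a CM field (`σ` = complex conjugation = the Rosati/adjoint involution),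
`k ∈ K` acts as a Hodge ISOMETRY iff `k · σ k = 1`, i.e. iff `k ∈ N¹` (Hilbert 90); Hodge isometries
are algebraic (Buskin, Huybrechts), algebraic classes form a `ℚ`-subspace, hence ALL of `K` is
algebraic on `S × S`.

The algebraicity hypothesis cannot be dropped: for `K = ℚ(t)`, `σ t = -t`, every `r(t)/r(-t)` is
regular at `t = ∞`, so the `ℚ`-algebra generated by `N¹` lies in the valuation ring at `∞` and omits
`t` (erratum to the s18 statement, which asserted the lemma for every separable quadratic `K/K₀`).

Proof (division-free except for inverses of algebraic elements, `Subalgebra.inv_mem_of_algebraic`):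
let `A = ℚ[N¹]` (`= span_ℚ N¹`, as `N¹` is a submonoid).  Pick `w ≠ 0` with `σ w = -w`.  For `σ`-fixed
`c` put `z = 1 + c w`, `u = z/σz`, `u' = σz/z ∈ N¹`; then `u + u' + 2 = 4/(z·σz)` and
`(u - u')·(z·σz) = 4 c w`, so `z σ z ∈ A` (inverse of an element of `A`) and `c w ∈ A`; with `c = 1`,
`w ∈ A`, `w⁻¹ ∈ A`, hence every `σ`-fixed `c` lies in `A`, and `K = K₀ ⊕ K₀ w ⊆ A`.
-/

namespace Summit.HodgeConjecture.HodgeConjecture.Theorems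

variable {K : Type*} [Field K]

/-- The norm-one quotients `z / σ z`, `z ≠ 0`, as a submonoid of `K`. -/
def normOneQuotients (σ : K ≃+* K) : Submonoid K where
  carrier := {x | ∃ z : K, z ≠ 0 ∧ x = z / σ z}
  one_mem' := ⟨1, one_ne_zero, by simp⟩
  mul_mem' := by
    rintro x y ⟨z, hz, rfl⟩ ⟨u, hu, rfl⟩
    refine ⟨z * u, mul_ne_zero hz hu, ?_⟩
    rw [map_mul, div_mul_div_comm]

/-- `z / σ z` is a norm-one quotient for every `z ≠ 0`. -/
theorem mem_normOneQuotients {σ : K ≃+* K} {z : K} (hz : z ≠ 0) :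
    z / σ z ∈ normOneQuotients σ := ⟨z, hz, rfl⟩

section CharZero

variable [CharZero K]

/-- The `ℚ`-span of the norm-one quotients is the `ℚ`-subalgebra they generate (they form a monoid). -/
theorem span_normOneQuotients_eq_adjoin (σ : K ≃+* K) :
    Submodule.span ℚ (normOneQuotients σ : Set K) =
      Subalgebra.toSubmodule (Algebra.adjoin ℚ (normOneQuotients σ : Set K)) := by
  rw [Algebra.adjoin_eq_span, Submonoid.closure_eq]

/-- **Span lemma.** For an involution `σ ≠ id` of a field `K` algebraic over `ℚ`, the quotients
`z / σ z` (`z ≠ 0`) span `K` over `ℚ`. -/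
theorem span_normOneQuotients_eq_top [Algebra.IsAlgebraic ℚ K] (σ : K ≃+* K)
    (hσ : ∀ x, σ (σ x) = x) (hσ' : ∃ x, σ x ≠ x) :
    Submodule.span ℚ (normOneQuotients σ : Set K) = ⊤ := by
  rw [span_normOneQuotients_eq_adjoin, Submodule.eq_top_iff']
  set A : Subalgebra ℚ K := Algebra.adjoin ℚ (normOneQuotients σ : Set K) with hA
  change ∀ x : K, x ∈ A
  -- members of `N¹` are members of `A`
  have hN : ∀ {z : K}, z ≠ 0 → z / σ z ∈ A := fun hz =>
    Algebra.subset_adjoin (mem_normOneQuotients hz)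
  -- inverses of members of `A` are members of `A` (algebraicity)
  have hinv : ∀ {y : K}, y ∈ A → y⁻¹ ∈ A := fun {y} hy =>
    A.inv_mem_of_algebraic (x := ⟨y, hy⟩) (Algebra.IsAlgebraic.isAlgebraic y)
  -- rational multiples
  have hsmul : ∀ (q : ℚ) {y : K}, y ∈ A → (q : K) * y ∈ A := fun q {y} hy => by
    have := A.smul_mem hy q
    rwa [Algebra.smul_def] at this
  -- an anti-invariant element `w ≠ 0`
  obtain ⟨x₀, hx₀⟩ := hσ'
  set w : K := x₀ - σ x₀ with hw_def
  have hw : σ w = -w := by rw [hw_def, map_sub, hσ, neg_sub]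
  have hw0 : w ≠ 0 := fun h => hx₀ (sub_eq_zero.mp h).symm
  have hw0' : -w ≠ 0 := neg_ne_zero.mpr hw0
  have h2 : (2 : K) ≠ 0 := two_ne_zero
  -- an element which is both fixed and anti-fixed vanishes (char 0)
  have hfix_anti : ∀ {y : K}, σ y = y → σ y = -y → y = 0 := by
    intro y h1 h2'
    have : (2 : K) * y = 0 := by linear_combination h2' - h1
    rcases mul_eq_zero.mp this with h | h
    · exact absurd h h2
    · exact h
  -- KEY STEP: for every `σ`-fixed `c`, `c * w ∈ A`
  have key : ∀ c : K, σ c = c → c * w ∈ A := by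
    intro c hc
    have hσcw : σ (c * w) = -(c * w) := by rw [map_mul, hc, hw, mul_neg]
    set z : K := 1 + c * w with hz_def
    have hσz : σ z = 2 - z := by
      rw [hz_def, map_add, map_one, hσcw]; ring
    have hcw : c * w = z - 1 := by rw [hz_def]; ring
    have hz0 : z ≠ 0 := by
      intro h
      have hcw1 : c * w = -1 := by rw [hcw, h]; ring
      have : σ (c * w) = c * w := by rw [hcw1, map_neg, map_one]
      have := hfix_anti this hσcw
      rw [this] at hcw1; norm_num at hcw1
    have hσz0 : σ z ≠ 0 := by
      intro h
      have hcw1 : c * w = 1 := by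
        rw [hσz] at h; rw [hcw]; linear_combination -h
      have : σ (c * w) = c * w := by rw [hcw1, map_one]
      have := hfix_anti this hσcw
      rw [this] at hcw1; norm_num at hcw1
    have h2z : (2 : K) - z ≠ 0 := by rw [← hσz]; exact hσz0
    have hu : z / σ z ∈ A := hN hz0
    have hu' : σ z / z ∈ A := by
      have := hN hσz0
      rwa [hσ] at this
    -- `z * σ z ∈ A`: its inverse is `(u + u' + 2) / 4`
    have hprod : z * σ z ∈ A := by
      have hq : (z * σ z)⁻¹ = (((1 : ℚ) / 4 : ℚ) : K) * (z / σ z + σ z / z + 2) := by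
        rw [hσz]
        push_cast
        field_simp
        ring
      have hmem : (((1 : ℚ) / 4 : ℚ) : K) * (z / σ z + σ z / z + 2) ∈ A := by
        refine hsmul _ (A.add_mem (A.add_mem hu hu') ?_)
        simp
      have : ((z * σ z)⁻¹)⁻¹ ∈ A := hinv (by rw [hq]; exact hmem)
      rwa [inv_inv] at this
    -- `c * w = (u - u') * (z σ z) / 4`
    have hq : c * w = (((1 : ℚ) / 4 : ℚ) : K) * ((z / σ z - σ z / z) * (z * σ z)) := by
      rw [hcw, hσz]
      push_cast
      field_simp
      ring
    rw [hq]
    exact hsmul _ (A.mul_mem (A.sub_mem hu hu') hprod)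
  -- hence `w ∈ A`, `w⁻¹ ∈ A`, and every fixed `c` is in `A`
  have hwA : w ∈ A := by simpa using key 1 (map_one σ)
  have hwinv : w⁻¹ ∈ A := hinv hwA
  have hfix : ∀ c : K, σ c = c → c ∈ A := by
    intro c hc
    have : c * w * w⁻¹ ∈ A := A.mul_mem (key c hc) hwinv
    rwa [mul_inv_cancel_right₀ hw0] at this
  -- decomposition `x = (x + σ x)/2 + ((x - σ x)/2 * w⁻¹) * w`
  intro x
  have hc₀ : σ ((x + σ x) / 2) = (x + σ x) / 2 := by
    rw [map_div₀, map_add, hσ, map_ofNat, add_comm]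
  have hc₁ : σ ((x - σ x) / 2 * w⁻¹) = (x - σ x) / 2 * w⁻¹ := by
    rw [map_mul, map_div₀, map_sub, hσ, map_ofNat, map_inv₀, hw]
    field_simp
    ring
  have hx : x = (x + σ x) / 2 + (x - σ x) / 2 * w⁻¹ * w := by
    field_simp
    ring
  rw [hx]
  exact A.add_mem (hfix _ hc₀) (A.mul_mem (hfix _ hc₁) hwA)

end CharZero

end Summit.HodgeConjecture.HodgeConjecture.Theorems
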